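import Mathlib
import Summits.ResolutionOfSingularities.ResolutionOfSingularities.Theorems.WeightedInvariantLocalWeightedDropPolyDescentTailTools
import Summits.ResolutionOfSingularities.ResolutionOfSingularities.Theorems.WeightedInvariantLocalWeightedDropPolyDescentShearBeta

/-!
# `WeightedInvariant.LocalWeightedDrop`, stub S3ρ: the monic polyhedron descent — THE β-NEUTRAL TAIL: point steps, parameters, the limit shear,
# the prepared straightened labels `Â m` (piece ρ-T, part 3c; CJS Thm 13.7 / Claim 13.8 set-up)

Crux item stmt-ResolutionOfSingularities-8899 `LocalWeightedDrop` (route `ResolutionOfSingularities/WeightedInvariant`), registered skeleton v30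
(09f812eb3be8b7d8), stub S3ρ `stub_wildMonicSurfaceReductionWon`.  [OURS · L1 W4.3, chain w43, lead prover (gen 3); a LINE UNDER THE STUB: the
monic polyhedron descent (memo `L/res-L1-w43-lead-1/g3/S3RHO-CJS-MEMO.md`, line file `poly_descent_line_v1.lean` evidence on stmt-8899), MODEL
Cossart–Jannsen–Saito LNM 2270 Ch. 11–13 for `J = (y^d + Σ_{j<d} A_j y^j)`, `e = 2`, `k` a field; nothing here is a statement of any manuscript.
Pure-power instance: `…PureDescentNoChain` (p507072); degree-2 instance `…MonicDescentTailPointStep` (p493102 ff.).]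

Along a β-neutral chain `A` of well-prepared positions (all steps `V(y,u₁)`-blow-ups or point moves answered by the `u₁`-chart of `A m` or of
`prep (shearT (C λ) (A m))`), with Hironaka's vertex preparation (ρ-P) and minimality (ρ-M) as hypotheses `hprep`, `hmin`:
* generic bookkeeping `ptIdx π hex m i` (index of the `i`-th `π`-step at or after `m`) and the LIMIT SHEAR `hser π λ hex m` (coefficient of `u₁^i` =
  parameter of the `i`-th step after `m`) with `hser m = C λ_m + u₁ · hser (m+1)` at a step / `hser (m+1) = hser m` otherwise;
* `IsPointStepT`, `param`, `succ_eq_divOneT`, `pointStep_cases`, `pointStep_shape` (`A (m+1) = blowOneT (shift (shearT (C λ_m) (A m)) ψ)`, `ψ(0) = 0`,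
  a position), `alphaL_succ_of_not_isPointStepT` (`α` drops by `d!` at a curve step), `exists_isPointStepT_ge` (infinitely many point steps);
* `Slab` / `Ahat` — the straightened label `S m = shearT (hser m) (A m)` and its preparation `Â m = prep (S m)`: a well-prepared position with non-empty
  Newton set and the `α`, `β` of `A m` (`Ahat_spec`); `V(y,u₁)`-permissible at curve steps; `ε(Â m) < d!` at point steps (else a GRAPH CURVE, excluded
  by β-neutrality).
-/

set_option linter.dupNamespace false -- mandated namespace of this single-conjunct summit

noncomputable section

namespace Summit.ResolutionOfSingularities.ResolutionOfSingularities.Theorems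

namespace PolyDescent

open MvPowerSeries MonicDescent WildMonic Literature.RingTheory.TwoVariableSeries Literature.AlgebraicGeometry.Resolution

variable {k : Type} [Field k]

/-! ## Indices of the point steps and the limit shear (generic in the step predicate `π` and the parameters `λ`) -/

section Generic

variable (π : ℕ → Prop) (lam : ℕ → k) (hex : ∀ m, ∃ n, m ≤ n ∧ π n)

open Classical in
/-- The index of the `i`-th `π`-step at or after `m`. -/
noncomputable def ptIdx (m : ℕ) : ℕ → ℕ
  | 0 => Nat.find (hex m)
  | i + 1 => Nat.find (hex (ptIdx m i + 1))

open Classical in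
/-- `ptIdx m 0` is a `π`-step `≥ m`, and the least such. -/
theorem ptIdx_zero_spec (m : ℕ) : m ≤ ptIdx π hex m 0 ∧ π (ptIdx π hex m 0) ∧ ∀ n, m ≤ n → π n → ptIdx π hex m 0 ≤ n := by
  refine ⟨(Nat.find_spec (hex m)).1, (Nat.find_spec (hex m)).2, fun n hmn hn => ?_⟩
  exact Nat.find_min' (hex m) ⟨hmn, hn⟩

/-- At a `π`-step `m`: the `0`-th step after `m` is `m` itself. -/
theorem ptIdx_zero_of_step {m : ℕ} (hm : π m) : ptIdx π hex m 0 = m :=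
  le_antisymm ((ptIdx_zero_spec π hex m).2.2 m le_rfl hm) (ptIdx_zero_spec π hex m).1

/-- At a non-step `m`: the steps after `m` are those after `m + 1`. -/
theorem ptIdx_zero_of_not_step {m : ℕ} (hm : ¬ π m) : ptIdx π hex m 0 = ptIdx π hex (m + 1) 0 := by
  apply le_antisymm
  · exact (ptIdx_zero_spec π hex m).2.2 _ (by have := (ptIdx_zero_spec π hex (m + 1)).1; omega)
      (ptIdx_zero_spec π hex (m + 1)).2.1
  · refine (ptIdx_zero_spec π hex (m + 1)).2.2 _ ?_ (ptIdx_zero_spec π hex m).2.1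
    have h1 := (ptIdx_zero_spec π hex m).1
    rcases Nat.eq_or_lt_of_le h1 with h | h
    · exact absurd (h ▸ (ptIdx_zero_spec π hex m).2.1) hm
    · omega

open Classical in
/-- Shift of the step index at a step. -/
theorem ptIdx_succ_of_step {m : ℕ} (hm : π m) (i : ℕ) : ptIdx π hex m (i + 1) = ptIdx π hex (m + 1) i := by
  induction i with
  | zero =>
    show Nat.find (hex (ptIdx π hex m 0 + 1)) = ptIdx π hex (m + 1) 0
    rw [ptIdx_zero_of_step π hex hm]
    rfl
  | succ i ih =>
    show Nat.find (hex (ptIdx π hex m (i + 1) + 1)) = Nat.find (hex (ptIdx π hex (m + 1) i + 1))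
    rw [ih]

open Classical in
/-- Shift of the step index at a non-step. -/
theorem ptIdx_of_not_step {m : ℕ} (hm : ¬ π m) (i : ℕ) : ptIdx π hex m i = ptIdx π hex (m + 1) i := by
  induction i with
  | zero => exact ptIdx_zero_of_not_step π hex hm
  | succ i ih =>
    show Nat.find (hex (ptIdx π hex m i + 1)) = Nat.find (hex (ptIdx π hex (m + 1) i + 1))
    rw [ih]

/-- THE LIMIT SHEAR at time `m`: the series in `u₁` whose coefficient of `u₁^i` is the parameter of the `i`-th step after `m`
(CJS Claim 13.8's `v = u₂ + Σ λ_j u₁^{j+1}`, read from time `m` on). -/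
noncomputable def hser (m : ℕ) : MvPowerSeries (Fin 2) k :=
  fun e => if e 1 = 0 then lam (ptIdx π hex m (e 0)) else 0

/-- Coefficients of the limit shear. -/
theorem coeff_hser (m : ℕ) (e : Fin 2 →₀ ℕ) :
    coeff e (hser π lam hex m) = if e 1 = 0 then lam (ptIdx π hex m (e 0)) else 0 := rfl

/-- The limit shear is a series in `u₁` only. -/
theorem hser_noY (m : ℕ) : ∀ e : Fin 2 →₀ ℕ, e 1 ≠ 0 → coeff e (hser π lam hex m) = 0 := by
  intro e he
  rw [coeff_hser, if_neg he]

/-- STEP RELATION: `hser m = C (λ m) + u₁ · hser (m+1)` at a step. -/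
theorem hser_of_step {m : ℕ} (hm : π m) : hser π lam hex m = C (lam m) + X 0 * hser π lam hex (m + 1) := by
  ext e
  rw [coeff_hser, map_add, coeff_C, show (X 0 : MvPowerSeries (Fin 2) k) = monomial (Finsupp.single 0 1) 1 from X_def 0,
    coeff_monomial_mul]
  by_cases he1 : e 1 = 0
  · rw [if_pos he1]
    by_cases he0 : e 0 = 0
    · have he : e = 0 := finsupp_fin2_ext (by simpa using he0) (by simpa using he1)
      subst he
      simp only [Finsupp.coe_zero, Pi.zero_apply, ptIdx_zero_of_step π hex hm, if_true]
      rw [if_neg (by intro h; have := h 0; simp at this), add_zero]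
    · rw [if_neg (by intro h; exact he0 (by rw [h]; rfl)), zero_add, if_pos (by intro i; fin_cases i <;> simp; omega), one_mul,
        coeff_hser, if_pos (by simpa using he1)]
      have : (e - Finsupp.single 0 1 : Fin 2 →₀ ℕ) 0 = e 0 - 1 := by simp
      rw [this]
      obtain ⟨j, hj⟩ : ∃ j, e 0 = j + 1 := ⟨e 0 - 1, by omega⟩
      rw [hj, ptIdx_succ_of_step π hex hm j]
      simp
  · rw [if_neg he1, if_neg (by intro h; apply he1; rw [h]; rfl), zero_add]
    split_ifs with hle
    · rw [coeff_hser, if_neg (by simpa using he1), mul_zero]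
    · rfl

/-- NON-STEP RELATION: `hser (m+1) = hser m`. -/
theorem hser_of_not_step {m : ℕ} (hm : ¬ π m) : hser π lam hex (m + 1) = hser π lam hex m := by
  ext e
  rw [coeff_hser, coeff_hser]
  split_ifs
  · rw [ptIdx_of_not_step π hex hm]
  · rfl

end Generic

/-! ## The β-neutral chain: point steps, curve steps, parameters -/

section Tail

variable {d : ℕ} (A : ℕ → (Fin d → MvPowerSeries (Fin 2) k))

/-- A POINT STEP of the neutral chain: `V(y,u₁)` is not permissible at `A m`. -/
def IsPointStepT (m : ℕ) : Prop := ¬ IsPermissibleOneT d (A m)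

open Classical in
/-- The PARAMETER `λ_m` of step `m`: the `c` of a `(1:c)` point step, `0` otherwise. -/
noncomputable def param (m : ℕ) : k :=
  if h : IsPointStepT A m ∧ ∃ c : k, c ≠ 0 ∧ A (m + 1) = blowOneT d (prep d (shearT (C c) (A m))) then Classical.choose h.2 else 0

variable (hprep : ∀ A : Fin d → MvPowerSeries (Fin 2) k, IsPosT d A → ∃ ψ : MvPowerSeries (Fin 2) k, IsPrepRecentring d A ψ)
  (hmin : ∀ (B : Fin d → MvPowerSeries (Fin 2) k) (ψ : MvPowerSeries (Fin 2) k), WellPrepared d B → IsPosT d B → constantCoeff ψ = 0 →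
    ∀ w : Fin 2 → ℕ, (∀ i, 0 < w i) → ∀ P ∈ newtonSet B, ∃ Q ∈ newtonSet (shift d B ψ), Finsupp.weight w Q ≤ Finsupp.weight w P)
  (hA : ∀ m, WellPrepared d (A m) ∧ IsPosT d (A m) ∧ (newtonSet (A m)).Nonempty ∧ IsNeutralStepT d (A m) (A (m + 1)))

include hA in
/-- At a curve step the next label is `A m / u₁^{d−·}`. -/
theorem succ_eq_divOneT {m : ℕ} (hm : ¬ IsPointStepT A m) : A (m + 1) = divOneT d (A m) := by
  unfold IsPointStepT at hm
  push Not at hm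
  rcases (hA m).2.2.2 with ⟨-, h⟩ | ⟨h1, -⟩
  · exact h
  · exact absurd hm h1

include hA in
/-- At a point step: no axis curve, no graph curve, and the next label is `blowOneT (A m)` or `blowOneT (prep (shearT (C c) (A m)))`, `c ≠ 0`. -/
theorem pointStep_cases {m : ℕ} (hm : IsPointStepT A m) :
    ¬ IsPermissibleOneT d (A m) ∧ ¬ IsPermissibleTwoT d (A m) ∧ ¬ HasGraphCurveT d (A m) ∧
      ∃ c : k, (c = 0 ∧ A (m + 1) = blowOneT d (A m)) ∨ (c ≠ 0 ∧ A (m + 1) = blowOneT d (prep d (shearT (C c) (A m)))) := by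
  rcases (hA m).2.2.2 with ⟨h1, -⟩ | ⟨h1, h2, h3, h⟩
  · exact absurd h1 hm
  · refine ⟨h1, h2, h3, ?_⟩
    rcases h with h | ⟨c, hc, h⟩
    · exact ⟨0, Or.inl ⟨rfl, h⟩⟩
    · exact ⟨c, Or.inr ⟨hc, h⟩⟩

include hprep hA in
/-- UNIFIED POINT-STEP SHAPE: `A (m+1) = blowOneT Q` with `Q` a position re-centring `shearT (C λ_m) (A m)` by some `ψ` without constant term
(`ψ = 0` for `λ_m = 0`, the preparing re-centring otherwise). -/
theorem pointStep_shape {m : ℕ} (hm : IsPointStepT A m) :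
    ∃ ψ : MvPowerSeries (Fin 2) k, constantCoeff ψ = 0 ∧ IsPosT d (shift d (shearT (C (param A m)) (A m)) ψ) ∧
      A (m + 1) = blowOneT d (shift d (shearT (C (param A m)) (A m)) ψ) := by
  obtain ⟨-, -, -, c, hc⟩ := pointStep_cases A hA hm
  by_cases hex' : ∃ c : k, c ≠ 0 ∧ A (m + 1) = blowOneT d (prep d (shearT (C c) (A m)))
  · have hparam : param A m = Classical.choose hex' := by
      unfold param; rw [dif_pos ⟨hm, hex'⟩]
    obtain ⟨-, hAeq⟩ := Classical.choose_spec hex'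
    rw [← hparam] at hAeq
    obtain ⟨hψ0, hpos, -, -⟩ := isPrepRecentring_prepPsi (hprep _ (isPosT_shearT (C (param A m)) (hA m).2.1))
    exact ⟨_, hψ0, hpos, hAeq⟩
  · have hparam : param A m = 0 := by
      unfold param; rw [dif_neg (fun h => hex' h.2)]
    rcases hc with ⟨-, hAeq⟩ | ⟨hcne, hAeq⟩
    · refine ⟨0, map_zero _, ?_, ?_⟩
      · rw [hparam, map_zero, shearT_zero, shift_zero']; exact (hA m).2.1
      · rw [hAeq, hparam, map_zero, shearT_zero, shift_zero']
    · exact absurd ⟨c, hcne, hAeq⟩ hex'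

include hA in
/-- `α` drops by exactly `d!` at a curve step. -/
theorem alphaL_succ_of_not_isPointStepT {m : ℕ} (hm : ¬ IsPointStepT A m) :
    alphaL (newtonSet (A (m + 1))) + d.factorial = alphaL (newtonSet (A m)) := by
  have hP1 : IsPermissibleOneT d (A m) := by unfold IsPointStepT at hm; push Not at hm; exact hm
  rw [succ_eq_divOneT A hA hm, newtonSet_divOneT (A m) hP1, alphaL_image_shift_add (shiftOneF_fst hP1) (hA m).2.2.1]

include hA in
/-- INFINITELY MANY POINT STEPS: a run of curve steps lowers `α` by `d!` each time. -/
theorem exists_isPointStepT_ge (m : ℕ) : ∃ n, m ≤ n ∧ IsPointStepT A n := by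
  by_contra h
  push Not at h
  have hdec : ∀ j, alphaL (newtonSet (A (m + j))) + d.factorial * j = alphaL (newtonSet (A m)) := by
    intro j
    induction j with
    | zero => simp
    | succ j ih =>
      have hstep := alphaL_succ_of_not_isPointStepT A hA (h (m + j) (by omega))
      rw [show m + (j + 1) = m + j + 1 from by omega, Nat.mul_succ]
      omega
  have := hdec (alphaL (newtonSet (A m)) + 1)
  have h1 : alphaL (newtonSet (A m)) + 1 ≤ d.factorial * (alphaL (newtonSet (A m)) + 1) :=
    Nat.le_mul_of_pos_left _ (Nat.factorial_pos d)
  omega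

/-! ## The prepared straightened labels `Â m = prep (shearT (hser m) (A m))` -/

section Hat

variable (hex : ∀ m, ∃ n, m ≤ n ∧ IsPointStepT A n)

/-- The STRAIGHTENED label `S m = (A m)(u₁, u₂ + u₁·hser m)` (slotwise). -/
noncomputable def Slab (m : ℕ) : Fin d → MvPowerSeries (Fin 2) k := shearT (hser (IsPointStepT A) (param A) hex m) (A m)

/-- The PREPARED STRAIGHTENED label `Â m = prep (S m)`. -/
noncomputable def Ahat (m : ℕ) : Fin d → MvPowerSeries (Fin 2) k := prep d (Slab A hex m)

include hA in
/-- `S m` is a position. -/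
theorem isPosT_Slab (m : ℕ) : IsPosT d (Slab A hex m) := isPosT_shearT _ (hA m).2.1

include hprep hA in
/-- The preparing re-centring of `S m` is well-preparing ((ρ-P)). -/
theorem prep_Slab (m : ℕ) : IsPrepRecentring d (Slab A hex m) (prepPsi d (Slab A hex m)) :=
  isPrepRecentring_prepPsi (hprep _ (isPosT_Slab A hA hex m))

/-- `Â m` is `S m` re-centred by its preparing re-centring. -/
theorem Ahat_eq (m : ℕ) : Ahat A hex m = shift d (Slab A hex m) (prepPsi d (Slab A hex m)) := rfl

include hprep hmin hA in
/-- `Â m` is a well-prepared position with non-empty Newton set and the same `α`, `β` as `A m` ((ρ-P) + (ρ-M): `alphaL_betaL_prep_shearT`). -/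
theorem Ahat_spec (m : ℕ) :
    WellPrepared d (Ahat A hex m) ∧ IsPosT d (Ahat A hex m) ∧ (newtonSet (Ahat A hex m)).Nonempty ∧
      alphaL (newtonSet (Ahat A hex m)) = alphaL (newtonSet (A m)) ∧ betaL (newtonSet (Ahat A hex m)) = betaL (newtonSet (A m)) := by
  have hpr := prep_Slab A hprep hA hex m
  obtain ⟨hne, hα, hβ⟩ := alphaL_betaL_prep_shearT hmin (hA m).1 (hA m).2.2.1 hpr
  exact ⟨hpr.2.2.1, hpr.2.1, hne, hα, hβ⟩

include hprep hmin hA in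
/-- At a curve step `Â m` is `V(y,u₁)`-permissible as well (same `α ≥ d!` as `A m`). -/
theorem isPermissibleOneT_Ahat_of_not_isPointStepT {m : ℕ} (hm : ¬ IsPointStepT A m) : IsPermissibleOneT d (Ahat A hex m) := by
  have hP1 : IsPermissibleOneT d (A m) := by unfold IsPointStepT at hm; push Not at hm; exact hm
  apply isPermissibleOneT_of_factorial_le_alphaL
  rw [(Ahat_spec A hprep hmin hA hex m).2.2.2.1]
  obtain ⟨P, hP, hP0⟩ := exists_eq_alphaL (hA m).2.2.1
  rw [← hP0]
  exact factorial_le_fst_of_isPermissibleOneT hP1 P hP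

include hprep hA in
/-- At a point step `ε(Â m) < d!`: otherwise `V(y, ũ₂)` would be permissible for the prepared sheared label, i.e. `A m` would have a GRAPH CURVE
(`h = hser m`, `ψ` the preparing re-centring), which β-neutrality excludes at point steps. -/
theorem epsL_Ahat_lt_of_isPointStepT {m : ℕ} (hm : IsPointStepT A m) : epsL (newtonSet (Ahat A hex m)) < d.factorial := by
  by_contra hge
  push Not at hge
  have hperm : IsPermissibleTwoT d (Ahat A hex m) := isPermissibleTwoT_of_factorial_le_epsL hge
  exact (pointStep_cases A hA hm).2.2.1
    ⟨hser (IsPointStepT A) (param A) hex m, prepPsi d (Slab A hex m), hser_noY _ _ hex m, (prep_Slab A hprep hA hex m).1, hperm⟩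

end Hat

end Tail

end PolyDescent

end Summit.ResolutionOfSingularities.ResolutionOfSingularities.Theorems

end
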